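import Mathlib
import Summits.KontsevichZagierPeriods.Zeta5Search.BrickPropositionHTwo
import Summits.KontsevichZagierPeriods.Zeta5Search.BrickCellReflectionTwo

/-!
# BrickPropositionHTwoSharp — PROPOSITION H at the prime `2` with ONE MORE FACTOR `2`: for `A` even, `1 ≤ B`, `2B ≤ A`,
every level `ℓ`, every row `M < 2^{ℓ+1}`, every 2-admissible weight `g` and every ODD order `s ≤ A`,
`v₂(Σ_{k≤M} g(k)·2^{ℓ(A−s)}c̃_{k,s}(M)) ≤ exp(−(ℓ+1))` — the spare factor is the PAIRING `k ↔ M − k`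
(cell `pub-zeta5`, seat ct-1 g44)

HONEST FRAMING: systematic search; no irrationality claim unless certified.  `2`-adic bookkeeping of the partial-fraction
cells of the centre-free brick kernels `R_n(t) = n!^{A−2B}(t−n)_n^B(t+n+1)_n^B/(t)_{n+1}^A`; nothing about `ζ(5)`/`ζ(3)`; no
`γ` / record statement; records in print UNMOVED; NOTHING IS DISCHARGED here (net named-fact debt 0).  Theorems only (0 `def`).

ct-1 g43's `BrickPropositionHTwo.propositionH_two` gives `exp(−ℓ)` for every `s`; its README §4 recorded the numerical margin
`1` («KR 2007 strength at `p = 2` … a sharpened residue law would give it»).  NO new residue law is needed: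

* for ODD `s ≤ A` the centre-free cells are reflection-odd, `c̃_{M−k,s}(M) = −c̃_{k,s}(M)` (`A` even;
  `BrickCellReflectionTwo.cell_zero_reflect_odd`), and a 2-admissible weight is EXACTLY antisymmetric, so
  `Σ_k g(k)X_k = 2·Σ_{2k<M} g(k)X_k` (`sum_antisymm_pair`);
* ct-1 g42's one-level reduction (`BrickLevelReductionTwo.level_reduction_two_odd/_even`) needs ONLY `g ∈ ℤ_(2)`, so it
  applies to the HALF weight `g′ = g·[2k < M]`; the block / hole weights of `g − g′` are minus the reflected ones of `g′`
  (`blockWeight_two_odd_reflect_gen`, `blockWeight_two_even_reflect_gen`, `holeWeight_two_reflect_gen`), hence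
  `ΣWY = 2ΣW′Y`, `ΣGZ = 2ΣG′Z` (`sum_pair_of_reflect`) and
  `ΣgX = 2·(Σg′X − ΣW′Y [− ΣG′Z]) + ΣWY [+ ΣGZ]`;
* `W = 2ω`, `G = 2^Aγ` with `ω`, `γ` 2-admissible one level down (ct-1 g43's `BrickWeightDescentTwo`), so the induction
  hypothesis WITH the extra factor applies to `ω`, `γ`: every term is `O(2^{L+2})`.

* `level_step_two_odd_sharp`, `level_step_two_even_sharp` — the induction steps (rows `2N+1`, `2N+2`);
* **`propositionH_two_sharp`** — the statement above (base `M ≤ 1`: pairing + `BrickCellsAllPrimes.cell_zero_integral_of_lt`);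
* `weightedSum_eq_zero_of_even` — for `A − s` even the antisymmetrically weighted sum VANISHES identically;
* `propositionH_two_sharp_linear` — the weight `n − 2k`.
The harmonic cell is NOT sharpened (its printed factor `2` is genuine: `KrattenthalerRivoal2007.conjecture1_constantTerm_false`).
DATA (seat desk `alg/sharpcheck.py`, exact, not used by the kernel): the sharp bound is attained (margin exactly 0 over `ℓ+1`)
at some odd `s` for each of nine bricks `(A,B)`, `n ≤ 20`.
-/

namespace Summit.KontsevichZagierPeriods.Zeta5Search.BrickPropositionHTwoSharp

open Finset Nat WithZero
open Summit.KontsevichZagierPeriods.Zeta5Search.BrickLaurent (cell)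
open Summit.KontsevichZagierPeriods.Zeta5Search.BrickLevelReduction (blockWeight)
open Summit.KontsevichZagierPeriods.Zeta5Search.BrickHoleWeight (holeWeight)
open Summit.KontsevichZagierPeriods.Zeta5Search.BrickCellsAllPrimes (cell_zero_integral_of_lt)
open Summit.KontsevichZagierPeriods.Zeta5Search.BrickResidueLawTwo (padicValuation_two padicValuation_two_pow)
open Summit.KontsevichZagierPeriods.Zeta5Search.BrickLevelReductionTwo (level_reduction_two_odd level_reduction_two_even)
open Summit.KontsevichZagierPeriods.Zeta5Search.BrickBlockWeightTwo (blockWeight_two_odd_le padicValuation_blockWeight_two_even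
  holeWeight_two_le)
open Summit.KontsevichZagierPeriods.Zeta5Search.BrickWeightDescentTwo (padicValuation_natCast_sub_le blockWeight_two_odd_reflect
  blockWeight_two_odd_local even_row_le blockWeight_two_even_reflect blockWeight_two_even_local holeWeight_two_reflect
  holeWeight_two_local)
open Summit.KontsevichZagierPeriods.Zeta5Search.BrickPropositionHTwo (padicValuation_div_two_pow_le sum_pow_mul)
open Summit.KontsevichZagierPeriods.Zeta5Search.BrickCellReflectionTwo (cell_zero_reflect_odd cell_zero_reflect_even
  sum_pair_of_reflect sum_antisymm_pair blockWeight_congr blockWeight_sub blockWeight_neg holeWeight_congr holeWeight_sub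
  holeWeight_neg blockWeight_two_odd_reflect_gen blockWeight_two_even_reflect_gen holeWeight_two_reflect_gen)

noncomputable section

/-- A restricted weight `g·[P]` stays `2`-integral. -/
theorem padicValuation_ite_le {g : ℕ → ℚ} {k : ℕ} {P : Prop} [Decidable P] (h : Rat.padicValuation 2 (g k) ≤ 1) :
    Rat.padicValuation 2 (if P then g k else 0) ≤ 1 := by
  split_ifs
  · exact h
  · rw [map_zero]; exact _root_.zero_le

/-- The scaled cells of a row are reflection-odd for odd `s ≤ A` (`A` even): `X(n−k) = −X(k)`, `X(k) = 2^c·c̃_{k,s}(n)`. -/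
theorem scaled_cell_reflect_odd {A : ℕ} (hA : Even A) (B : ℕ) {n : ℕ} (c : ℕ) {s : ℕ} (hs : Odd s) (hsA : s ≤ A) :
    ∀ k, k ≤ n → (2 : ℚ) ^ c * cell A B 0 n (n - k) s = -((2 : ℚ) ^ c * cell A B 0 n k s) := fun k hk => by
  rw [cell_zero_reflect_odd hA B hk hs hsA, mul_neg]

/-! ## The induction step with the extra factor -/

section step

variable {A B L : ℕ} (hA : Even A) (hB : 1 ≤ B) (hAB : 2 * B ≤ A)
  (IH : ∀ M, M < 2 ^ (L + 1) → ∀ g' : ℕ → ℚ, (∀ K, K ≤ M → Rat.padicValuation 2 (g' K) ≤ 1) →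
    (∀ K, K ≤ M → g' (M - K) + g' K = 0) →
    (∀ e K K', e ≤ L → K ≤ M → K' ≤ M → (2 : ℤ) ^ e ∣ (K : ℤ) - K' →
      Rat.padicValuation 2 (g' K' - g' K) ≤ exp (-((e : ℤ) + 1))) →
    ∀ s, Odd s → s ≤ A → Rat.padicValuation 2 (∑ K ∈ range (M + 1), g' K * ((2 : ℚ) ^ (L * (A - s)) * cell A B 0 M K s)) ≤
      exp (-((L : ℤ) + 1)))
include hA hB hAB IH

/-- **The sharp step on an ODD row `2N+1`** (`N < 2^{L+1}`, `g` 2-admissible at level `L+1`, odd `s ≤ A`):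
`v₂(Σ_k g(k)·2^{(L+1)(A−s)}c̃_{k,s}(2N+1)) ≤ exp(−(L+2))`.  With the half weight `g′ = g·[2k < 2N+1]` and `W′ = blockWeight g′`:
`ΣgX = 2(Σg′X − ΣW′Y) + ΣWY`, the bracket is `O(2^{L+1})` by ct-1 g42's reduction and `ΣWY = 2ΣωY = O(2^{L+2})` by the
hypothesis at level `L` for `ω = W/2`. -/
theorem level_step_two_odd_sharp {N : ℕ} (hN : N < 2 ^ (L + 1)) {g : ℕ → ℚ}
    (hgI : ∀ k, k ≤ 2 * N + 1 → Rat.padicValuation 2 (g k) ≤ 1)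
    (hgS : ∀ k, k ≤ 2 * N + 1 → g (2 * N + 1 - k) + g k = 0)
    (hgD : ∀ e k k', e ≤ L + 1 → k ≤ 2 * N + 1 → k' ≤ 2 * N + 1 → (2 : ℤ) ^ e ∣ (k : ℤ) - k' →
      Rat.padicValuation 2 (g k' - g k) ≤ exp (-((e : ℤ) + 1))) {s : ℕ} (hs : Odd s) (hsA : s ≤ A) :
    Rat.padicValuation 2 (∑ k ∈ range (2 * N + 1 + 1),
      g k * ((2 : ℚ) ^ ((L + 1) * (A - s)) * cell A B 0 (2 * N + 1) k s)) ≤ exp (-((L : ℤ) + 1 + 1)) := by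
  set W : ℕ → ℚ := blockWeight A B 0 2 1 N g with hW
  set ω : ℕ → ℚ := fun K => W K / 2 with hω
  have hWω : ∀ K, W K = (2 : ℚ) ^ 1 * ω K := fun K => by rw [hω]; simp only; rw [pow_one, mul_div_cancel₀ _ two_ne_zero]
  -- `ω` is 2-admissible for `N` at level `L` (ct-1 g43)
  have hωI : ∀ K, K ≤ N → Rat.padicValuation 2 (ω K) ≤ 1 := fun K hK => by
    have h := padicValuation_div_two_pow_le 1
      (blockWeight_two_odd_le hAB hK (hgI (2 * K) (by omega)) (hgI (2 * K + 1) (by omega)))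
    rw [pow_one] at h
    exact h.trans (by rw [← exp_zero, exp_le_exp]; push_cast; omega)
  have hωS : ∀ K, K ≤ N → ω (N - K) + ω K = 0 := fun K hK => by
    rw [hω]; simp only; rw [← add_div, hW, blockWeight_two_odd_reflect hA hgS hK, zero_div]
  have hωD : ∀ e K K', e ≤ L → K ≤ N → K' ≤ N → (2 : ℤ) ^ e ∣ (K : ℤ) - K' →
      Rat.padicValuation 2 (ω K' - ω K) ≤ exp (-((e : ℤ) + 1)) := fun e K K' he hK hK' hdvd => by
    rw [hω]; simp only; rw [← sub_div]
    have h := padicValuation_div_two_pow_le 1 (blockWeight_two_odd_local hA hB hAB hgI hgS hgD he hK hK' hdvd)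
    rw [pow_one] at h
    exact h.trans (by rw [exp_le_exp]; push_cast; omega)
  have IHω := IH N hN ω hωI hωS hωD s hs hsA
  -- the half weight and its reduction
  set g' : ℕ → ℚ := fun k => if 2 * k < 2 * N + 1 then g k else 0 with hg'
  have hg'I : ∀ k, k ≤ 2 * N + 1 → Rat.padicValuation 2 (g' k) ≤ 1 := fun k hk => padicValuation_ite_le (hgI k hk)
  have hred := level_reduction_two_odd hAB hB (L := L) hN hg'I s
  set W' : ℕ → ℚ := blockWeight A B 0 2 1 N g' with hW'
  -- reflection-odd values on the rows `2N+1` and `N`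
  have hX := scaled_cell_reflect_odd hA B (n := 2 * N + 1) ((L + 1) * (A - s)) hs hsA
  have hY := scaled_cell_reflect_odd hA B (n := N) (L * (A - s)) hs hsA
  -- pairing of the cells
  have hpair1 : ∑ k ∈ range (2 * N + 1 + 1), g k * ((2 : ℚ) ^ ((L + 1) * (A - s)) * cell A B 0 (2 * N + 1) k s) =
      2 * ∑ k ∈ range (2 * N + 1 + 1), g' k * ((2 : ℚ) ^ ((L + 1) * (A - s)) * cell A B 0 (2 * N + 1) k s) :=
    sum_antisymm_pair hgS hX
  -- pairing of the block weights: `W − W′ = −W′(N − ·)`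
  have hW'' : ∀ K, K ≤ N → W K - W' K = -W' (N - K) := fun K hK => by
    rw [hW, hW', ← blockWeight_sub, blockWeight_two_odd_reflect_gen hA B g' hK, ← blockWeight_neg]
    refine blockWeight_congr (fun k hk => ?_) hK
    have hgk : g k = -g (2 * N + 1 - k) := by linarith [hgS k (by omega)]
    show g k - (if 2 * k < 2 * N + 1 then g k else 0) = -(if 2 * (2 * N + 1 - k) < 2 * N + 1 then g (2 * N + 1 - k) else 0)
    by_cases h1 : 2 * k < 2 * N + 1
    · rw [if_pos h1, if_neg (by omega)]; ring
    · rw [if_neg h1, if_pos (by omega), hgk]; ring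
  have hpair2 : ∑ K ∈ range (N + 1), W K * ((2 : ℚ) ^ (L * (A - s)) * cell A B 0 N K s) =
      2 * ∑ K ∈ range (N + 1), W' K * ((2 : ℚ) ^ (L * (A - s)) * cell A B 0 N K s) :=
    sum_pair_of_reflect (W'' := fun K => W K - W' K) (fun K _ => by ring) hW'' hY
  -- `ΣWY = 2ΣωY = O(2^{L+2})`
  have hWY : Rat.padicValuation 2 (∑ K ∈ range (N + 1), W K * ((2 : ℚ) ^ (L * (A - s)) * cell A B 0 N K s)) ≤
      exp (-((L : ℤ) + 1 + 1)) := by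
    rw [show ∑ K ∈ range (N + 1), W K * ((2 : ℚ) ^ (L * (A - s)) * cell A B 0 N K s) =
      ∑ K ∈ range (N + 1), ((2 : ℚ) ^ 1 * ω K) * ((2 : ℚ) ^ (L * (A - s)) * cell A B 0 N K s) from
        Finset.sum_congr rfl fun K _ => by rw [hWω K], sum_pow_mul, map_mul, padicValuation_two_pow]
    calc _ ≤ exp (-((1 : ℕ) : ℤ)) * exp (-((L : ℤ) + 1)) := mul_le_mul' le_rfl IHω
      _ = _ := by rw [← exp_add]; congr 1; push_cast; ring
  -- assemble
  have key : ∑ k ∈ range (2 * N + 1 + 1), g k * ((2 : ℚ) ^ ((L + 1) * (A - s)) * cell A B 0 (2 * N + 1) k s) =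
      2 * (∑ k ∈ range (2 * N + 1 + 1), g' k * ((2 : ℚ) ^ ((L + 1) * (A - s)) * cell A B 0 (2 * N + 1) k s) -
        ∑ K ∈ range (N + 1), W' K * ((2 : ℚ) ^ (L * (A - s)) * cell A B 0 N K s)) +
      ∑ K ∈ range (N + 1), W K * ((2 : ℚ) ^ (L * (A - s)) * cell A B 0 N K s) := by
    rw [hpair1, hpair2]; ring
  rw [key]
  refine Valuation.map_add_le _ ?_ hWY
  rw [map_mul, padicValuation_two]
  calc _ ≤ exp (-1 : ℤ) * exp (-((L : ℤ) + 1)) := mul_le_mul' le_rfl hred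
    _ = _ := by rw [← exp_add]; congr 1; ring

/-- **The sharp step on an EVEN row `2N+2`** (`N + 1 < 2^{L+1}`, `g` 2-admissible at level `L+1`, odd `s ≤ A`):
`v₂(Σ_k g(k)·2^{(L+1)(A−s)}c̃_{k,s}(2N+2)) ≤ exp(−(L+2))`.  Here `ΣgX = 2(Σg′X − ΣW′Y − ΣG′Z) + ΣWY + ΣGZ` with the ° block
weights on the row `N+1` (`W = 2ω`) and the hole weights on the row `N` (`G = 2^Aγ`). -/
theorem level_step_two_even_sharp {N : ℕ} (hN : N + 1 < 2 ^ (L + 1)) {g : ℕ → ℚ}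
    (hgI : ∀ k, k ≤ 2 * N + 2 → Rat.padicValuation 2 (g k) ≤ 1)
    (hgS : ∀ k, k ≤ 2 * N + 2 → g (2 * N + 2 - k) + g k = 0)
    (hgD : ∀ e k k', e ≤ L + 1 → k ≤ 2 * N + 2 → k' ≤ 2 * N + 2 → (2 : ℤ) ^ e ∣ (k : ℤ) - k' →
      Rat.padicValuation 2 (g k' - g k) ≤ exp (-((e : ℤ) + 1))) {s : ℕ} (hs : Odd s) (hsA : s ≤ A) :
    Rat.padicValuation 2 (∑ k ∈ range (2 * N + 2 + 1),
      g k * ((2 : ℚ) ^ ((L + 1) * (A - s)) * cell A B 0 (2 * N + 2) k s)) ≤ exp (-((L : ℤ) + 1 + 1)) := by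
  have hA1 : 1 ≤ A := by omega
  have hN' : N < 2 ^ (L + 1) := by omega
  -- the block weight `W = 2ω` on the row `N+1` (ct-1 g43)
  set W : ℕ → ℚ := blockWeight A B 0 2 0 (N + 1) g with hW
  set ω : ℕ → ℚ := fun K => W K / 2 with hω
  have hWω : ∀ K, W K = (2 : ℚ) ^ 1 * ω K := fun K => by rw [hω]; simp only; rw [pow_one, mul_div_cancel₀ _ two_ne_zero]
  have hωI : ∀ K, K ≤ N + 1 → Rat.padicValuation 2 (ω K) ≤ 1 := fun K hK => by
    have hWK : Rat.padicValuation 2 (W K) ≤ exp (-1 : ℤ) := by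
      rw [hW, padicValuation_blockWeight_two_even hAB hK]; exact even_row_le hgS hgD (by omega)
    have h := padicValuation_div_two_pow_le 1 hWK
    rw [pow_one] at h
    exact h.trans (by rw [← exp_zero, exp_le_exp]; norm_num)
  have hωS : ∀ K, K ≤ N + 1 → ω (N + 1 - K) + ω K = 0 := fun K hK => by
    rw [hω]; simp only; rw [← add_div, hW, blockWeight_two_even_reflect hA hAB hgS hK, zero_div]
  have hωD : ∀ e K K', e ≤ L → K ≤ N + 1 → K' ≤ N + 1 → (2 : ℤ) ^ e ∣ (K : ℤ) - K' →
      Rat.padicValuation 2 (ω K' - ω K) ≤ exp (-((e : ℤ) + 1)) := fun e K K' he hK hK' hdvd => by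
    rw [hω]; simp only; rw [← sub_div]
    have h := padicValuation_div_two_pow_le 1 (blockWeight_two_even_local hAB hgS hgD he hK hK' hdvd)
    rw [pow_one] at h
    exact h.trans (by rw [exp_le_exp]; push_cast; omega)
  have IHω := IH (N + 1) hN ω hωI hωS hωD s hs hsA
  -- the hole weight `G = 2^A γ` on the row `N` (ct-1 g43)
  set G : ℕ → ℚ := holeWeight A B 0 2 0 N g with hG
  set γ : ℕ → ℚ := fun K => G K / (2 : ℚ) ^ A with hγ
  have hGγ : ∀ K, G K = (2 : ℚ) ^ A * γ K := fun K => by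
    rw [hγ]; simp only; rw [mul_div_cancel₀ _ (pow_ne_zero A two_ne_zero)]
  have hγI : ∀ K, K ≤ N → Rat.padicValuation 2 (γ K) ≤ 1 := fun K hK => by
    have h := padicValuation_div_two_pow_le A (holeWeight_two_le hAB hK (hgI (2 * K + 1) (by omega)))
    rw [neg_add_cancel, exp_zero] at h
    simpa only [hγ, hG] using h
  have hγS : ∀ K, K ≤ N → γ (N - K) + γ K = 0 := fun K hK => by
    rw [hγ]; simp only; rw [← add_div, hG, holeWeight_two_reflect hA hgS hK, zero_div]
  have hγD : ∀ e K K', e ≤ L → K ≤ N → K' ≤ N → (2 : ℤ) ^ e ∣ (K : ℤ) - K' →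
      Rat.padicValuation 2 (γ K' - γ K) ≤ exp (-((e : ℤ) + 1)) := fun e K K' he hK hK' hdvd => by
    rw [hγ]; simp only; rw [← sub_div]
    have h := padicValuation_div_two_pow_le A (holeWeight_two_local hAB hgS hgD he hK hK' hdvd)
    exact h.trans (by rw [exp_le_exp]; omega)
  have IHγ := IH N hN' γ hγI hγS hγD s hs hsA
  -- the half weight and its reduction
  set g' : ℕ → ℚ := fun k => if 2 * k < 2 * N + 2 then g k else 0 with hg'
  have hg'I : ∀ k, k ≤ 2 * N + 2 → Rat.padicValuation 2 (g' k) ≤ 1 := fun k hk => padicValuation_ite_le (hgI k hk)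
  have hred := level_reduction_two_even hAB (L := L) hN hg'I hA1 s
  set W' : ℕ → ℚ := blockWeight A B 0 2 0 (N + 1) g' with hW'
  set G' : ℕ → ℚ := holeWeight A B 0 2 0 N g' with hG'
  -- reflection-odd values on the rows `2N+2`, `N+1`, `N`
  have hX := scaled_cell_reflect_odd hA B (n := 2 * N + 2) ((L + 1) * (A - s)) hs hsA
  have hY := scaled_cell_reflect_odd hA B (n := N + 1) (L * (A - s)) hs hsA
  have hZ := scaled_cell_reflect_odd hA B (n := N) (L * (A - s)) hs hsA
  -- `g − g′ = −g′(2N+2 − ·)` on the row (the middle value `g(N+1)` vanishes)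
  have hgg' : ∀ k, k ≤ 0 + (N + 1) * 2 → g k - g' k = -g' (2 * N + 2 - k) := fun k hk => by
    have hgk : g k = -g (2 * N + 2 - k) := by linarith [hgS k (by omega)]
    show g k - (if 2 * k < 2 * N + 2 then g k else 0) = -(if 2 * (2 * N + 2 - k) < 2 * N + 2 then g (2 * N + 2 - k) else 0)
    by_cases h1 : 2 * k < 2 * N + 2
    · rw [if_pos h1, if_neg (by omega)]; ring
    · rw [if_neg h1]
      by_cases h2 : 2 * (2 * N + 2 - k) < 2 * N + 2
      · rw [if_pos h2, hgk]; ring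
      · obtain rfl : k = N + 1 := by omega
        rw [if_neg h2, sub_zero, neg_zero]
        rw [show 2 * N + 2 - (N + 1) = N + 1 by omega] at hgk
        linarith
  -- pairing of the cells, the block weights, the hole weights
  have hpair1 : ∑ k ∈ range (2 * N + 2 + 1), g k * ((2 : ℚ) ^ ((L + 1) * (A - s)) * cell A B 0 (2 * N + 2) k s) =
      2 * ∑ k ∈ range (2 * N + 2 + 1), g' k * ((2 : ℚ) ^ ((L + 1) * (A - s)) * cell A B 0 (2 * N + 2) k s) :=
    sum_antisymm_pair hgS hX
  have hW'' : ∀ K, K ≤ N + 1 → W K - W' K = -W' (N + 1 - K) := fun K hK => by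
    rw [hW, hW', ← blockWeight_sub, blockWeight_two_even_reflect_gen hA B g' hK, ← blockWeight_neg]
    exact blockWeight_congr (fun k hk => hgg' k hk) hK
  have hpair2 : ∑ K ∈ range (N + 1 + 1), W K * ((2 : ℚ) ^ (L * (A - s)) * cell A B 0 (N + 1) K s) =
      2 * ∑ K ∈ range (N + 1 + 1), W' K * ((2 : ℚ) ^ (L * (A - s)) * cell A B 0 (N + 1) K s) :=
    sum_pair_of_reflect (W'' := fun K => W K - W' K) (fun K _ => by ring) hW'' hY
  have hG'' : ∀ K, K ≤ N → G K - G' K = -G' (N - K) := fun K hK => by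
    rw [hG, hG', ← holeWeight_sub, holeWeight_two_reflect_gen hA B g' hK, ← holeWeight_neg]
    exact holeWeight_congr (fun k hk => hgg' k hk) hK
  have hpair3 : ∑ K ∈ range (N + 1), G K * ((2 : ℚ) ^ (L * (A - s)) * cell A B 0 N K s) =
      2 * ∑ K ∈ range (N + 1), G' K * ((2 : ℚ) ^ (L * (A - s)) * cell A B 0 N K s) :=
    sum_pair_of_reflect (W'' := fun K => G K - G' K) (fun K _ => by ring) hG'' hZ
  -- `ΣWY = 2ΣωY = O(2^{L+2})`, `ΣGZ = 2^AΣγZ = O(2^{A+L+1})`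
  have hWY : Rat.padicValuation 2 (∑ K ∈ range (N + 1 + 1), W K * ((2 : ℚ) ^ (L * (A - s)) * cell A B 0 (N + 1) K s)) ≤
      exp (-((L : ℤ) + 1 + 1)) := by
    rw [show ∑ K ∈ range (N + 1 + 1), W K * ((2 : ℚ) ^ (L * (A - s)) * cell A B 0 (N + 1) K s) =
      ∑ K ∈ range (N + 1 + 1), ((2 : ℚ) ^ 1 * ω K) * ((2 : ℚ) ^ (L * (A - s)) * cell A B 0 (N + 1) K s) from
        Finset.sum_congr rfl fun K _ => by rw [hWω K], sum_pow_mul, map_mul, padicValuation_two_pow]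
    calc _ ≤ exp (-((1 : ℕ) : ℤ)) * exp (-((L : ℤ) + 1)) := mul_le_mul' le_rfl IHω
      _ = _ := by rw [← exp_add]; congr 1; push_cast; ring
  have hGZ : Rat.padicValuation 2 (∑ K ∈ range (N + 1), G K * ((2 : ℚ) ^ (L * (A - s)) * cell A B 0 N K s)) ≤
      exp (-((L : ℤ) + 1 + 1)) := by
    rw [show ∑ K ∈ range (N + 1), G K * ((2 : ℚ) ^ (L * (A - s)) * cell A B 0 N K s) =
      ∑ K ∈ range (N + 1), ((2 : ℚ) ^ A * γ K) * ((2 : ℚ) ^ (L * (A - s)) * cell A B 0 N K s) from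
        Finset.sum_congr rfl fun K _ => by rw [hGγ K], sum_pow_mul, map_mul, padicValuation_two_pow]
    calc _ ≤ exp (-(A : ℤ)) * exp (-((L : ℤ) + 1)) := mul_le_mul' le_rfl IHγ
      _ ≤ _ := by rw [← exp_add, exp_le_exp]; omega
  -- assemble
  have key : ∑ k ∈ range (2 * N + 2 + 1), g k * ((2 : ℚ) ^ ((L + 1) * (A - s)) * cell A B 0 (2 * N + 2) k s) =
      2 * (∑ k ∈ range (2 * N + 2 + 1), g' k * ((2 : ℚ) ^ ((L + 1) * (A - s)) * cell A B 0 (2 * N + 2) k s) -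
        ∑ K ∈ range (N + 1 + 1), W' K * ((2 : ℚ) ^ (L * (A - s)) * cell A B 0 (N + 1) K s) -
        ∑ K ∈ range (N + 1), G' K * ((2 : ℚ) ^ (L * (A - s)) * cell A B 0 N K s)) +
      ∑ K ∈ range (N + 1 + 1), W K * ((2 : ℚ) ^ (L * (A - s)) * cell A B 0 (N + 1) K s) +
      ∑ K ∈ range (N + 1), G K * ((2 : ℚ) ^ (L * (A - s)) * cell A B 0 N K s) := by
    rw [hpair1, hpair2, hpair3]; ring
  rw [key]
  refine Valuation.map_add_le _ (Valuation.map_add_le _ ?_ hWY) hGZ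
  rw [map_mul, padicValuation_two]
  calc _ ≤ exp (-1 : ℤ) * exp (-((L : ℤ) + 1)) := mul_le_mul' le_rfl hred
    _ = _ := by rw [← exp_add]; congr 1; ring

end step

/-! ## PROPOSITION H at `2` with the extra factor -/

/-- **SHARP PROPOSITION H at `p = 2`.**  For `A` even, `1 ≤ B`, `2B ≤ A`, EVERY level `ℓ`, every row `M < 2^{ℓ+1}` of the
centre-free kernel `(A,B,0)`, every weight `g` that is 2-ADMISSIBLE at level `ℓ` — (I) `v₂(g(k)) ≤ 1`, (S) `g(M−k) + g(k) = 0`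
exactly, (D⁺) `2^e ∣ k − k′ ⇒ v₂(g(k′) − g(k)) ≤ exp(−(e+1))` for `e ≤ ℓ` — and every ODD `s ≤ A`:
`v₂(Σ_{k≤M} g(k)·2^{ℓ(A−s)}·c̃_{k,s}(M)) ≤ exp(−(ℓ+1))` — one factor `2` beyond `BrickPropositionHTwo.propositionH_two`. -/
theorem propositionH_two_sharp {A B : ℕ} (hA : Even A) (hB : 1 ≤ B) (hAB : 2 * B ≤ A) :
    ∀ ℓ : ℕ, ∀ M : ℕ, M < 2 ^ (ℓ + 1) → ∀ g : ℕ → ℚ, (∀ k, k ≤ M → Rat.padicValuation 2 (g k) ≤ 1) →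
      (∀ k, k ≤ M → g (M - k) + g k = 0) →
      (∀ e k k', e ≤ ℓ → k ≤ M → k' ≤ M → (2 : ℤ) ^ e ∣ (k : ℤ) - k' →
        Rat.padicValuation 2 (g k' - g k) ≤ exp (-((e : ℤ) + 1))) →
      ∀ s, Odd s → s ≤ A →
        Rat.padicValuation 2 (∑ k ∈ range (M + 1), g k * ((2 : ℚ) ^ (ℓ * (A - s)) * cell A B 0 M k s)) ≤
          exp (-((ℓ : ℤ) + 1)) := by
  intro ℓ
  induction ℓ with
  | zero =>
    intro M hM g hgI hgS _ s hs hsA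
    rw [zero_add, pow_one] at hM
    have hX := scaled_cell_reflect_odd hA B (n := M) (0 * (A - s)) hs hsA
    rw [sum_antisymm_pair hgS hX, map_mul, padicValuation_two, Nat.cast_zero, zero_add]
    calc _ ≤ exp (-1 : ℤ) * 1 := mul_le_mul' le_rfl (Valuation.map_sum_le _ fun k hk => ?_)
      _ = exp (-1 : ℤ) := mul_one _
    have hk' : k ≤ M := by have := mem_range.1 hk; omega
    rw [map_mul, zero_mul, pow_zero, one_mul]
    exact mul_le_one' (padicValuation_ite_le (hgI k hk')) (cell_zero_integral_of_lt hAB hM hk' s)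
  | succ L ih =>
    intro M hM g hgI hgS hgD s hs hsA
    have hpow : 2 ^ (L + 1 + 1) = 2 * 2 ^ (L + 1) := by rw [pow_succ]; ring
    rcases Nat.even_or_odd' M with ⟨N, hMN | hMN⟩
    · rcases N with _ | N
      · -- the empty row `M = 0`: `g(0) = 0`
        obtain rfl : M = 0 := by omega
        have h0 : g 0 = 0 := by have h := hgS 0 le_rfl; rw [Nat.sub_zero] at h; linarith
        simp only [zero_add, Finset.sum_range_one, h0, zero_mul, map_zero]
        exact _root_.zero_le
      · -- even row `M = 2N+2`
        obtain rfl : M = 2 * N + 2 := by omega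
        have hN : N + 1 < 2 ^ (L + 1) := by omega
        have h := level_step_two_even_sharp hA hB hAB ih hN hgI hgS hgD hs hsA
        push_cast
        exact h
    · -- odd row `M = 2N+1`
      subst hMN
      have hN : N < 2 ^ (L + 1) := by omega
      have h := level_step_two_odd_sharp hA hB hAB ih hN hgI hgS hgD hs hsA
      push_cast
      exact h

/-- **Even orders vanish**: for `A` even, `A − s` even (every even `s`, and every `s > A`), ANY row `M`, any scale `c` and any
EXACTLY antisymmetric weight: `Σ_{k≤M} g(k)·(c·c̃_{k,s}(M)) = 0` (the cells are reflection-even, the weight reflection-odd). -/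
theorem weightedSum_eq_zero_of_even {A : ℕ} (hA : Even A) (B : ℕ) {M : ℕ} {g : ℕ → ℚ}
    (hgS : ∀ k, k ≤ M → g (M - k) + g k = 0) {s : ℕ} (hs : Even (A - s)) (c : ℚ) :
    ∑ k ∈ range (M + 1), g k * (c * cell A B 0 M k s) = 0 := by
  have h := Finset.sum_range_reflect (fun k => g k * (c * cell A B 0 M k s)) (M + 1)
  have h' : ∑ k ∈ range (M + 1), g (M + 1 - 1 - k) * (c * cell A B 0 M (M + 1 - 1 - k) s) =
      -∑ k ∈ range (M + 1), g k * (c * cell A B 0 M k s) := by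
    rw [← sum_neg_distrib]
    refine sum_congr rfl fun k hk => ?_
    have hk' : k ≤ M := by have := mem_range.1 hk; omega
    have hg : g (M - k) = -g k := by linarith [hgS k hk']
    rw [show M + 1 - 1 - k = M - k by omega, cell_zero_reflect_even B hk' hA hs, hg]
    ring
  rw [h'] at h
  linarith

/-- **The weight `n − 2k`, sharp**: for `A` even, `1 ≤ B`, `2B ≤ A`, every `ℓ`, `n < 2^{ℓ+1}` and every ODD `s ≤ A`:
`v₂(Σ_{k≤n} (n−2k)·2^{ℓ(A−s)}c̃_{k,s}(n)) ≤ exp(−(ℓ+1))`. -/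
theorem propositionH_two_sharp_linear {A B : ℕ} (hA : Even A) (hB : 1 ≤ B) (hAB : 2 * B ≤ A) (ℓ n : ℕ)
    (hn : n < 2 ^ (ℓ + 1)) {s : ℕ} (hs : Odd s) (hsA : s ≤ A) :
    Rat.padicValuation 2 (∑ k ∈ range (n + 1),
        ((n : ℚ) - 2 * k) * ((2 : ℚ) ^ (ℓ * (A - s)) * cell A B 0 n k s)) ≤ exp (-((ℓ : ℤ) + 1)) := by
  refine propositionH_two_sharp hA hB hAB ℓ n hn (fun k => (n : ℚ) - 2 * k) (fun k _ => ?_) (fun k hk => ?_)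
    (fun e k k' _ _ _ hdvd => ?_) s hs hsA
  · rw [show (n : ℚ) - 2 * k = (((n : ℤ) - 2 * k : ℤ) : ℚ) by push_cast; ring, Rat.padicValuation_cast]
    exact Int.padicValuation_le_one _ _
  · push_cast [Nat.cast_sub hk]; ring
  · rw [show ((n : ℚ) - 2 * k') - ((n : ℚ) - 2 * k) = 2 * ((k : ℚ) - k') by ring, map_mul, padicValuation_two]
    calc _ ≤ exp (-1 : ℤ) * exp (-(e : ℤ)) := mul_le_mul' le_rfl (padicValuation_natCast_sub_le hdvd)
      _ = _ := by rw [← exp_add]; congr 1; ring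

end

end Summit.KontsevichZagierPeriods.Zeta5Search.BrickPropositionHTwoSharp
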